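import Literature.AlgebraicGeometry.Frobenioids.DivSlimRemarkProofs
import Literature.AlgebraicGeometry.Frobenioids.BaseCategoryTheoreticityExamplesProofs
import HarnessLib

/-!
# Frobenioids I, Remark 4.12.1 — the named statement `Rmk4121.Statement` decided clause by clause

Mochizuki, *The geometry of Frobenioids I: the general theory*, Kyushu J. Math. **62** (2008)
293–400, kurims text p. 95 [cite: MochizukiFrdI2008, Rem. 4.12.1 p.95]:

  "One verifies immediately that if one takes the group `G` of Example 3.10 to be residually finite,
  then the Frobenioid of Example 3.10 is of rationally standard and unit-trivial type [but not of
  group-like type] over a Frobenius-slim base category [which is not Div-slim — cf. Remark 4.11.2]."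

PROOF-ONLY companion (cell abc-iut, D-0079 L-F sub-cell [FrdI/II], pack D row F-1023 of
`plan/L1/LF-FRD.tsv`; seat abc-iut-w5-d042) to the named statement `Rmk4121.Statement G R` of
`DivSlimRemark.lean` (seat abc-iut-L1-t3) — the conjunction, under `IsResiduallyFiniteGroup G`, of
(1) rationally standard type over the Def. 4.5 (iii) parameter `R` (a SCHEMA: `Ex310.data` is a bare
`PreFrobenioidData`, so THE birationalizations of Prop. 4.4 are not available for it by name), (2) unit-trivial
type, (3) not group-like type, (4) `D` Frobenius-slim, (5) `D` not Div-slim.  Results: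

* (2) `Ex310.isOfUnitTrivialType` — PROVED for every group `G` (the only base-identity linear automorphism of
  the object of `C = SingleObj (G × 𝔽)` is the identity: an invertible element of `𝔽 = F_{ℤ≥0}` is trivial);
* (3) is seat abc-iut-L1-t3's `Ex310.not_isOfGroupLikeType`, (4)/(5) are `Rmk4121.isFrobeniusSlim_D` /
  `Rmk4121.not_isDivSlim [Nontrivial G]` (`DivSlimRemarkProofs.lean`);
* `Rmk4121.statement_of_isOfRationallyStandardType` — for `G` NON-TRIVIAL the named statement holds at every
  parameter `R` at which conjunct (1) holds: the row is CLOSED MODULO ITS SCHEMA CONJUNCT, by name;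
* `Rmk4121.isDivSlim_of_subsingleton`, `Rmk4121.not_statement_of_subsingleton` — FINDING: as typed, the
  statement is FALSE for the trivial group (which is residually finite, and whose one-object category IS
  Div-slim: `Aut(D_A → D) ≅ G = 1`).  Print's Example 3.10 works with "any nontrivial homomorphism
  `α : 𝔽 → Z(G)`" (p. 72) and Remark 4.11.2's "not Div-slim" needs `G ≠ 1`, so the faithful instance form
  carries `[Nontrivial G]` — exactly the hypothesis of the landed `Rmk4121.not_isDivSlim`.

No definition, no new notion; no statement of the paper is restated or strengthened.  [FrdI] is a refereed
prerequisite paper — nothing here bears on [IUTchIII] Cor. 3.12.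
-/

namespace Literature.AlgebraicGeometry.Frobenioids

open CategoryTheory

namespace Ex310

variable {G : Type} [Group G]

/-- In `C = SingleObj (G × 𝔽)` the `𝔽`-component of an isomorphism is trivial.
[cite: MochizukiFrdI2008, Ex. 3.10 p.72] -/
theorem snd_eq_one_of_isIso {A B : C G} (φ : A ⟶ B) [IsIso φ] : snd φ = 1 := by
  have h : snd (inv φ ≫ φ) = 1 := by rw [IsIso.inv_hom_id]; rfl
  rw [snd_comp] at h
  exact StandardFrobenioid.eq_one_of_mul_eq_one h

variable (G) in
/-- **Remark 4.12.1, conjunct (2)** (FrdI p. 95): the Frobenioid `C = SingleObj (G × 𝔽) → D = SingleObj G`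
of Example 3.10 is of UNIT-TRIVIAL type — `O^×(A) = {1}`: a base-identity (`G`-component `1`) automorphism has
trivial `𝔽`-component. (No hypothesis on `G` is needed.) [cite: MochizukiFrdI2008, Rem. 4.12.1 p.95] -/
theorem isOfUnitTrivialType : (data G).IsOfUnitTrivialType := by
  refine ⟨fun A => (Subgroup.eq_bot_iff_forall _).mpr fun α hα => ?_⟩
  obtain ⟨hb, -⟩ := hα
  have h1 : (show G × StandardFrobenioid from α.hom).1 = 1 := hb
  have h2 : (show G × StandardFrobenioid from α.hom).2 = 1 := snd_eq_one_of_isIso α.hom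
  exact Aut.ext (Prod.ext h1 h2)

end Ex310

namespace Rmk4121

variable (G : Type) [Group G]

/-- **Remark 4.12.1 for `G` non-trivial, CLOSED MODULO ITS SCHEMA CONJUNCT**: if `G` is non-trivial and the
Frobenioid of Example 3.10 is of rationally standard type over the Def. 4.5 (iii) parameter `R` (whenever `G`
is residually finite), then the named statement `Rmk4121.Statement G R` holds — conjuncts (2)–(5) being
`Ex310.isOfUnitTrivialType`, `Ex310.not_isOfGroupLikeType`, `isFrobeniusSlim_D`, `not_isDivSlim`.
[cite: MochizukiFrdI2008, Rem. 4.12.1 p.95] -/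
theorem statement_of_isOfRationallyStandardType [Nontrivial G] (R : (Ex310.data G).RSParams)
    (hR : IsResiduallyFiniteGroup G → PreFrobenioidData.IsOfRationallyStandardType (Ex310.data G) R) :
    Statement G R := fun hG =>
  ⟨hR hG, Ex310.isOfUnitTrivialType G, Ex310.not_isOfGroupLikeType, isFrobeniusSlim_D G hG, not_isDivSlim G⟩

/-- **Remark 4.12.1, conjuncts (2)–(5) for `G` non-trivial and residually finite** (everything except the
rationally-standard schema conjunct). [cite: MochizukiFrdI2008, Rem. 4.12.1 p.95] -/
theorem statement_tail [Nontrivial G] (hG : IsResiduallyFiniteGroup G) :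
    (Ex310.data G).IsOfUnitTrivialType ∧ ¬ (Ex310.data G).IsOfGroupLikeType ∧
      IsFrobeniusSlim (Ex310.D G) ∧ ¬ (Ex310.data G).IsDivSlim :=
  ⟨Ex310.isOfUnitTrivialType G, Ex310.not_isOfGroupLikeType, isFrobeniusSlim_D G hG, not_isDivSlim G⟩

/-- For the TRIVIAL group the base `D = SingleObj G` of Example 3.10 IS Div-slim (vacuously:
`Aut(D_A → D) ≅ G` is trivial). [cite: MochizukiFrdI2008, Def. 4.5 (iv) p.86] -/
theorem isDivSlim_of_subsingleton [Subsingleton G] : (Ex310.data G).IsDivSlim :=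
  ⟨fun A _ _ =>
    (SingleObjAut.autForgetMulEquiv G : Aut (Over.forget A) ≃* G).injective (Subsingleton.elim _ _)⟩

/-- The trivial group is residually finite (vacuously). [cite: MochizukiFrdI2008, Rem. 3.1.2 p.58] -/
theorem isResiduallyFiniteGroup_of_subsingleton [Subsingleton G] : IsResiduallyFiniteGroup G :=
  fun g hg => absurd (Subsingleton.elim g 1) hg

/-- **FINDING (F-1023 instance-refuted at `G = 1`)**: as typed, `Rmk4121.Statement G R` is FALSE for the
trivial group and every parameter `R` — the trivial group is residually finite, yet its one-object category is
Div-slim, contradicting conjunct (5).  Print tacitly has `G ≠ 1` (Example 3.10: "any nontrivial homomorphism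
`α : 𝔽 → Z(G)`"; Remark 4.11.2); the faithful instance form is `statement_of_isOfRationallyStandardType`
under `[Nontrivial G]`. [cite: MochizukiFrdI2008, Rem. 4.12.1 p.95] -/
theorem not_statement_of_subsingleton [Subsingleton G] (R : (Ex310.data G).RSParams) :
    ¬ Statement G R := fun h =>
  (h (isResiduallyFiniteGroup_of_subsingleton G)).2.2.2.2 (isDivSlim_of_subsingleton G)

/-- The same at the literal instance `G = PUnit`. [cite: MochizukiFrdI2008, Rem. 4.12.1 p.95] -/
theorem not_statement_punit (R : (Ex310.data PUnit).RSParams) : ¬ Statement PUnit R :=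
  not_statement_of_subsingleton PUnit R

end Rmk4121

end Literature.AlgebraicGeometry.Frobenioids
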